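import Mathlib
import Summits.NavierStokesRegularity.NavierStokesRegularity.Theorems.FilamentSkeletonRssKelvinGateFreeResolvent
import Literature.Analysis.FluidPDE.KNSSMildGradientBound

/-!
# Route `FilamentSkeletonRss` · crux `TransverseReductionRJ` (stmt-NavierStokesRegularity-21221) — line `kelvin_gate`,
# stub S2′ `EventualKelvinGate`: the free resolvent GAINS a Hölder exponent — `D²W ∈ C^{0,β}` for every `β < 1`

Helper file (theorems only, `--supports stmt-NavierStokesRegularity-21221 --as helper`).  HONEST FRAMING: analysis
bookkeeping for a HYPOTHETICAL filament-type rotating-self-similar blow-up route; nothing here bears on Navier–Stokes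
regularity; no stub is proved here.

For `F ∈ C¹(ℝ³; ℝ³)` with `‖F‖ ≤ C₀`, `‖DF‖ ≤ C₁`, the free resolvent `W = ∫₀^∞ W_s ds` of `…KelvinGateFreeResolvent` is `C²`
(`contDiff_two_freeResolvent`).  This file proves the Schauder-type gain needed by the pressure step of the free gate
(PRESSURE-STEP-DESIGN note, item evidence on 21221; route "solve then project"):

* `norm_fderiv_fderiv2_apply_heatExtension_le` — two kernel derivatives on bounded `C¹` data, applied form:
  `‖D[z ↦ D²(e^{τΔ}F)(z)[v][w]]‖ ≤ 16 τ⁻¹ C₁ ‖v‖ ‖w‖` on `ℝ³`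
  (semigroup split `e^{τΔ} = e^{(τ/2)Δ} e^{(τ/2)Δ}` and the `t^{-1/2}` gradient bound twice);
* `norm_fderiv_fderiv_freeSlice_sub_le` — `‖D²W_s(y) − D²W_s(y')‖ ≤ 16 C₁ e^{-2s} τ_s⁻¹ ‖y − y'‖` (mean value);
* `norm_fderiv_fderiv_freeResolvent_sub_le` — **`‖D²W(y) − D²W(y')‖ ≤ 16 C₁ · I_β · ‖y − y'‖^β`** for `0 < β < 1`, with
  `I_β = ∫₀^∞ s^{-(1+β)/2} e^{-s} ds` (`= Γ((1−β)/2)`): the resolvent maps `C¹`-bounded data into `C^{2,β}`, uniformly, for every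
  rate `α`.
-/

set_option linter.dupNamespace false

noncomputable section

namespace Summit.NavierStokesRegularity.NavierStokesRegularity.Theorems.KelvinGate

open Set Function Filter Topology InnerProductSpace MeasureTheory Real Metric
open Literature.Analysis.FluidPDE Literature.Analysis.UnboundedOperators
open scoped Laplacian RealInnerProductSpace ContDiff Topology ENNReal BigOperators

section Gain

variable {F : EuclideanSpace ℝ (Fin 3) → EuclideanSpace ℝ (Fin 3)} {C₀ C₁ : ℝ}

/-! ## Two kernel derivatives on bounded `C¹` data (applied form) -/

/-- **`‖D[z ↦ D²(e^{τΔ}F)(z)[v][w]](x)‖ ≤ 16 τ⁻¹ C₁ ‖v‖ ‖w‖`** on `ℝ³` for `F ∈ C¹` with `‖F‖ ≤ C₀`, `‖DF‖ ≤ C₁`: one derivative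
falls on the data, the other two on the two halves of `e^{τΔ} = e^{(τ/2)Δ} e^{(τ/2)Δ}` (third derivatives are kept in applied
form `z ↦ D²(·)(z)[v][w]`, whose values are vectors). -/
theorem norm_fderiv_fderiv2_apply_heatExtension_le (hF : ContDiff ℝ 1 F) (h0 : ∀ z, ‖F z‖ ≤ C₀) (h1 : ∀ z, ‖fderiv ℝ F z‖ ≤ C₁)
    {τ : ℝ} (hτ : 0 < τ) (v w x : EuclideanSpace ℝ (Fin 3)) :
    ‖fderiv ℝ (fun z => fderiv ℝ (fderiv ℝ (heatExtension F τ)) z v w) x‖ ≤ 16 * τ⁻¹ * C₁ * ‖v‖ * ‖w‖ := by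
  have hfin : (Module.finrank ℝ (EuclideanSpace ℝ (Fin 3)) : ℝ) = 3 := by
    rw [finrank_euclideanSpace_fin]; norm_num
  have hτ2 : 0 < τ / 2 := by positivity
  have hC₁ : 0 ≤ C₁ := (norm_nonneg _).trans (h1 0)
  have hFd : Continuous (fderiv ℝ F) := hF.continuous_fderiv one_ne_zero
  have hmem : MemLp (fderiv ℝ F) ∞ (volume : Measure (EuclideanSpace ℝ (Fin 3))) := memLp_top_of_continuous_of_bound hFd h1
  -- `D(e^{τΔ}F) = e^{τΔ}(DF) = e^{(τ/2)Δ} H`, `H = e^{(τ/2)Δ}(DF)`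
  have hsemi : heatExtension (fderiv ℝ F) τ = heatExtension (heatExtension (fderiv ℝ F) (τ / 2)) (τ / 2) := by
    rw [heatExtension_add_holds hmem le_top hτ2 hτ2]; congr 1; ring
  have hfun : fderiv ℝ (heatExtension F τ) = heatExtension (heatExtension (fderiv ℝ F) (τ / 2)) (τ / 2) := by
    rw [← hsemi]; exact funext fun z => fderiv_heatExtension_of_bounded hF h0 h1 hτ z
  set H := heatExtension (fderiv ℝ F) (τ / 2) with hH
  have hHc : ContDiff ℝ 1 H := contDiff_heatExtension_of_bound hFd h1 hτ2
  have hH0 : ∀ z, ‖H z‖ ≤ C₁ := fun z => norm_heatExtension_le_of_bound h1 hτ2 z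
  set cτ : ℝ := (2 : ℝ) ^ ((3 : ℝ) / 2) * (τ / 2) ^ (-(1 / 2 : ℝ)) with hcτ
  have hcτ0 : 0 ≤ cτ := by positivity
  have hH1 : ∀ z, ‖fderiv ℝ H z‖ ≤ cτ * C₁ := fun z => by
    have h := norm_fderiv_heatExtension_le_of_bounded hFd.aestronglyMeasurable h1 hτ2 z
    rwa [hfin] at h
  -- `D²(e^{τΔ}F) = D(e^{(τ/2)Δ}H) = e^{(τ/2)Δ}(DH)`
  have hfun2 : fderiv ℝ (fderiv ℝ (heatExtension F τ)) = heatExtension (fderiv ℝ H) (τ / 2) := by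
    rw [hfun]; exact funext fun z => fderiv_heatExtension_of_bounded hHc hH0 hH1 hτ2 z
  -- evaluate at `(v, w)`: a continuous linear map commutes with the caloric extension
  set L : (EuclideanSpace ℝ (Fin 3) →L[ℝ] EuclideanSpace ℝ (Fin 3) →L[ℝ] EuclideanSpace ℝ (Fin 3)) →L[ℝ] EuclideanSpace ℝ (Fin 3) :=
    (ContinuousLinearMap.apply ℝ (EuclideanSpace ℝ (Fin 3)) w).comp
      (ContinuousLinearMap.apply ℝ (EuclideanSpace ℝ (Fin 3) →L[ℝ] EuclideanSpace ℝ (Fin 3)) v) with hL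
  have hLapp : ∀ A : EuclideanSpace ℝ (Fin 3) →L[ℝ] EuclideanSpace ℝ (Fin 3) →L[ℝ] EuclideanSpace ℝ (Fin 3), L A = A v w :=
    fun A => rfl
  have hDHc : Continuous (fderiv ℝ H) := hHc.continuous_fderiv one_ne_zero
  have hk : (fun z => fderiv ℝ (fderiv ℝ (heatExtension F τ)) z v w) = heatExtension (fun z => fderiv ℝ H z v w) (τ / 2) := by
    funext z
    rw [hfun2, ← hLapp, ← heatExtension_clm_comp_of_bound L (g := fderiv ℝ H) hDHc (C := cτ * C₁) hH1 hτ2 z]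
    simp only [hLapp]
  rw [hk]
  have hkb : ∀ z, ‖fderiv ℝ H z v w‖ ≤ cτ * C₁ * ‖v‖ * ‖w‖ := fun z =>
    calc ‖fderiv ℝ H z v w‖ ≤ ‖fderiv ℝ H z v‖ * ‖w‖ := ContinuousLinearMap.le_opNorm _ _
      _ ≤ ‖fderiv ℝ H z‖ * ‖v‖ * ‖w‖ := mul_le_mul_of_nonneg_right (ContinuousLinearMap.le_opNorm _ _) (norm_nonneg _)
      _ ≤ cτ * C₁ * ‖v‖ * ‖w‖ := by gcongr; exact hH1 z
  have hkc : Continuous fun z => fderiv ℝ H z v w := (hDHc.clm_apply continuous_const).clm_apply continuous_const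
  have h := norm_fderiv_heatExtension_le_of_bounded hkc.aestronglyMeasurable hkb hτ2 x
  rw [hfin] at h
  refine h.trans (le_of_eq ?_)
  -- `(2^{3/2} (τ/2)^{-1/2})² = 16/τ`
  have h8 : (2 : ℝ) ^ ((3 : ℝ) / 2) * (2 : ℝ) ^ ((3 : ℝ) / 2) = 8 := by
    rw [← rpow_add two_pos]; norm_num
  have hτr : (τ / 2) ^ (-(1 / 2 : ℝ)) * (τ / 2) ^ (-(1 / 2 : ℝ)) = (τ / 2)⁻¹ := by
    rw [← rpow_add hτ2, inv_div]; norm_num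
    rw [rpow_neg_one, inv_div]
  calc (2 : ℝ) ^ ((3 : ℝ) / 2) * (τ / 2) ^ (-(1 / 2 : ℝ)) * (cτ * C₁ * ‖v‖ * ‖w‖)
      = ((2 : ℝ) ^ ((3 : ℝ) / 2) * (2 : ℝ) ^ ((3 : ℝ) / 2)) * ((τ / 2) ^ (-(1 / 2 : ℝ)) * (τ / 2) ^ (-(1 / 2 : ℝ))) *
          C₁ * ‖v‖ * ‖w‖ := by rw [hcτ]; ring
    _ = 16 * τ⁻¹ * C₁ * ‖v‖ * ‖w‖ := by rw [h8, hτr]; field_simp; ring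

/-! ## Lipschitz bound of the slices' second derivatives -/

/-- **`‖D²W_s(y) − D²W_s(y')‖ ≤ 16 C₁ e^{-2s} τ_s⁻¹ ‖y − y'‖`** (mean value inequality for `z ↦ D²(e^{τ_sΔ}F)(z)[v][w]`, whose
derivative is bounded by `16 τ_s⁻¹ C₁ ‖v‖ ‖w‖`, composed with the rotation–dilation conjugation). -/
theorem norm_fderiv_fderiv_freeSlice_sub_le (hF : ContDiff ℝ 1 F) (h0 : ∀ z, ‖F z‖ ≤ C₀) (h1 : ∀ z, ‖fderiv ℝ F z‖ ≤ C₁)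
    (α : ℝ) {s : ℝ} (hs : 0 < s) (y y' : EuclideanSpace ℝ (Fin 3)) :
    ‖fderiv ℝ (fun z => fderiv ℝ (fun z => (Real.exp (-(s / 2)) • rotZL (-(α * s)))
        (heatExtension F (1 - Real.exp (-s)) ((Real.exp (-(s / 2)) • rotZL (α * s)) z))) z) y -
      fderiv ℝ (fun z => fderiv ℝ (fun z => (Real.exp (-(s / 2)) • rotZL (-(α * s)))
        (heatExtension F (1 - Real.exp (-s)) ((Real.exp (-(s / 2)) • rotZL (α * s)) z))) z) y'‖ ≤
      16 * C₁ * (exp (-(2 * s)) * (1 - exp (-s))⁻¹) * ‖y - y'‖ := by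
  have hFc := hF.continuous
  obtain ⟨hτ, _⟩ := heatTime_mem_Ioc hs
  have hC₁ : 0 ≤ C₁ := (norm_nonneg _).trans (h1 0)
  set Ls : EuclideanSpace ℝ (Fin 3) →L[ℝ] EuclideanSpace ℝ (Fin 3) := Real.exp (-(s / 2)) • rotZL (α * s) with hLs
  set g := heatExtension F (1 - Real.exp (-s)) with hg
  have hg3 : ContDiff ℝ 3 g := contDiff_heatExtension_of_bound hFc h0 hτ
  set T := fderiv ℝ (fun z => fderiv ℝ (fun z => (Real.exp (-(s / 2)) • rotZL (-(α * s)))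
        (heatExtension F (1 - Real.exp (-s)) ((Real.exp (-(s / 2)) • rotZL (α * s)) z))) z) y -
      fderiv ℝ (fun z => fderiv ℝ (fun z => (Real.exp (-(s / 2)) • rotZL (-(α * s)))
        (heatExtension F (1 - Real.exp (-s)) ((Real.exp (-(s / 2)) • rotZL (α * s)) z))) z) y' with hT
  refine ContinuousLinearMap.opNorm_le_bound₂ T (by positivity) fun v w => ?_
  simp only [hT, sub_apply]
  rw [fderiv_fderiv_freeSlice_apply hFc h0 α hs y v w,
    fderiv_fderiv_freeSlice_apply hFc h0 α hs y' v w, ← map_sub, norm_smul_rotZL_apply, abs_of_pos (exp_pos _)]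
  -- mean value for `φ z := D²g(z)[Ls v][Ls w]`
  have hdiff : ∀ z ∈ (univ : Set (EuclideanSpace ℝ (Fin 3))),
      DifferentiableAt ℝ (fun z => fderiv ℝ (fderiv ℝ g) z (Ls v) (Ls w)) z := fun z _ =>
    (((((hg3.fderiv_right (m := 2) le_rfl).fderiv_right (m := 1) le_rfl).clm_apply contDiff_const).clm_apply
      contDiff_const).differentiable one_ne_zero) z
  have hbound : ∀ z ∈ (univ : Set (EuclideanSpace ℝ (Fin 3))),
      ‖fderiv ℝ (fun z => fderiv ℝ (fderiv ℝ g) z (Ls v) (Ls w)) z‖ ≤ 16 * (1 - exp (-s))⁻¹ * C₁ * ‖Ls v‖ * ‖Ls w‖ :=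
    fun z _ => norm_fderiv_fderiv2_apply_heatExtension_le hF h0 h1 hτ (Ls v) (Ls w) z
  have hmv := (convex_univ).norm_image_sub_le_of_norm_fderiv_le hdiff hbound (mem_univ (Ls y')) (mem_univ (Ls y))
  rw [norm_smul_rotZL_apply, norm_smul_rotZL_apply, abs_of_pos (exp_pos _)] at hmv
  have hLdiff : ‖Ls y - Ls y'‖ ≤ exp (-(s / 2)) * ‖y - y'‖ := by
    rw [← map_sub, hLs, norm_smul_rotZL_apply, abs_of_pos (exp_pos _)]
  calc exp (-(s / 2)) * ‖fderiv ℝ (fderiv ℝ g) (Ls y) (Ls v) (Ls w) - fderiv ℝ (fderiv ℝ g) (Ls y') (Ls v) (Ls w)‖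
      ≤ exp (-(s / 2)) * (16 * (1 - exp (-s))⁻¹ * C₁ * (exp (-(s / 2)) * ‖v‖) * (exp (-(s / 2)) * ‖w‖) * ‖Ls y - Ls y'‖) :=
        mul_le_mul_of_nonneg_left hmv (exp_pos _).le
    _ ≤ exp (-(s / 2)) * (16 * (1 - exp (-s))⁻¹ * C₁ * (exp (-(s / 2)) * ‖v‖) * (exp (-(s / 2)) * ‖w‖) *
          (exp (-(s / 2)) * ‖y - y'‖)) := by gcongr
    _ = 16 * C₁ * ((exp (-(s / 2)) * exp (-(s / 2)) * exp (-(s / 2)) * exp (-(s / 2))) * (1 - exp (-s))⁻¹) *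
          ‖y - y'‖ * ‖v‖ * ‖w‖ := by ring
    _ = 16 * C₁ * (exp (-(2 * s)) * (1 - exp (-s))⁻¹) * ‖y - y'‖ * ‖v‖ * ‖w‖ := by
        rw [← exp_add, ← exp_add, ← exp_add]; congr 5; ring

/-! ## The Hölder gain -/

/-- Interpolated bound of the slices: `‖D²W_s(y) − D²W_s(y')‖ ≤ 16 C₁ · s^{-(1+β)/2} e^{-s} · ‖y − y'‖^β` for `0 ≤ β ≤ 1`. -/
theorem norm_fderiv_fderiv_freeSlice_sub_le_rpow (hF : ContDiff ℝ 1 F) (h0 : ∀ z, ‖F z‖ ≤ C₀) (h1 : ∀ z, ‖fderiv ℝ F z‖ ≤ C₁)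
    (α : ℝ) {β : ℝ} (hβ0 : 0 ≤ β) (hβ1 : β ≤ 1) {s : ℝ} (hs : 0 < s) (y y' : EuclideanSpace ℝ (Fin 3)) :
    ‖fderiv ℝ (fun z => fderiv ℝ (fun z => (Real.exp (-(s / 2)) • rotZL (-(α * s)))
        (heatExtension F (1 - Real.exp (-s)) ((Real.exp (-(s / 2)) • rotZL (α * s)) z))) z) y -
      fderiv ℝ (fun z => fderiv ℝ (fun z => (Real.exp (-(s / 2)) • rotZL (-(α * s)))
        (heatExtension F (1 - Real.exp (-s)) ((Real.exp (-(s / 2)) • rotZL (α * s)) z))) z) y'‖ ≤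
      16 * C₁ * (s ^ (-((1 + β) / 2)) * exp (-s)) * ‖y - y'‖ ^ β := by
  have hC₁ : 0 ≤ C₁ := (norm_nonneg _).trans (h1 0)
  have hy := norm_fderiv_fderiv_freeSlice_le_rpow hF h0 h1 α hs y
  have hy' := norm_fderiv_fderiv_freeSlice_le_rpow hF h0 h1 α hs y'
  have h := norm_fderiv_fderiv_freeSlice_sub_le hF h0 h1 α hs y y'
  set A := fderiv ℝ (fun z => fderiv ℝ (fun z => (Real.exp (-(s / 2)) • rotZL (-(α * s)))
        (heatExtension F (1 - Real.exp (-s)) ((Real.exp (-(s / 2)) • rotZL (α * s)) z))) z) y with hA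
  set B := fderiv ℝ (fun z => fderiv ℝ (fun z => (Real.exp (-(s / 2)) • rotZL (-(α * s)))
        (heatExtension F (1 - Real.exp (-s)) ((Real.exp (-(s / 2)) • rotZL (α * s)) z))) z) y' with hB
  have hAB : ‖A - B‖ ≤ ‖A‖ + ‖B‖ := norm_sub_le A B
  set x := ‖A - B‖ with hx
  -- (a) the sup bound: `x ≤ 2 · 2^{3/2} C₁ s^{-1/2} e^{-s} ≤ 16 C₁ e^{-s} s^{-1/2}`
  have hx0 : 0 ≤ x := hx ▸ norm_nonneg (A - B)
  have hsr : 0 ≤ s ^ (-(1 / 2 : ℝ)) := rpow_nonneg hs.le _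
  have ha : x ≤ 16 * C₁ * exp (-s) * s ^ (-(1 / 2 : ℝ)) := by
    have h22 : (2 : ℝ) ^ ((3 : ℝ) / 2) ≤ 4 := by
      calc (2 : ℝ) ^ ((3 : ℝ) / 2) ≤ (2 : ℝ) ^ (2 : ℝ) := rpow_le_rpow_of_exponent_le (by norm_num) (by norm_num)
        _ = 4 := by norm_num
    have hpos : 0 ≤ s ^ (-(1 / 2 : ℝ)) * exp (-s) := by positivity
    calc x ≤ ‖A‖ + ‖B‖ := hAB
      _ ≤ (2 : ℝ) ^ ((3 : ℝ) / 2) * C₁ * (s ^ (-(1 / 2 : ℝ)) * exp (-s)) +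
            (2 : ℝ) ^ ((3 : ℝ) / 2) * C₁ * (s ^ (-(1 / 2 : ℝ)) * exp (-s)) := add_le_add hy hy'
      _ ≤ 4 * C₁ * (s ^ (-(1 / 2 : ℝ)) * exp (-s)) + 4 * C₁ * (s ^ (-(1 / 2 : ℝ)) * exp (-s)) := by
            gcongr
      _ ≤ 16 * C₁ * exp (-s) * s ^ (-(1 / 2 : ℝ)) := by nlinarith [mul_nonneg hC₁ hpos]
  -- (b) the Lipschitz bound: `x ≤ 16 C₁ e^{-s} s⁻¹ ‖y − y'‖`
  have hs1 : 0 ≤ s ^ (-(1 : ℝ)) := rpow_nonneg hs.le _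
  have hb : x ≤ 16 * C₁ * exp (-s) * (s ^ (-(1 : ℝ)) * ‖y - y'‖) := by
    have hτ : (1 - exp (-s))⁻¹ ≤ s⁻¹ * exp s := by
      have hse : 0 < s * exp (-s) := by positivity
      calc (1 - exp (-s))⁻¹ ≤ (s * exp (-s))⁻¹ := inv_anti₀ hse (mul_exp_neg_le_heatTime s)
        _ = s⁻¹ * exp s := by rw [mul_inv, exp_neg, inv_inv]
    have hexp : exp (-(2 * s)) * exp s = exp (-s) := by rw [← exp_add]; congr 1; ring
    calc x ≤ 16 * C₁ * (exp (-(2 * s)) * (1 - exp (-s))⁻¹) * ‖y - y'‖ := h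
      _ ≤ 16 * C₁ * (exp (-(2 * s)) * (s⁻¹ * exp s)) * ‖y - y'‖ := by gcongr
      _ = 16 * C₁ * (exp (-(2 * s)) * exp s) * (s⁻¹ * ‖y - y'‖) := by ring
      _ = 16 * C₁ * exp (-s) * (s ^ (-(1 : ℝ)) * ‖y - y'‖) := by rw [hexp, rpow_neg_one]
  -- interpolate
  have hK : 0 ≤ 16 * C₁ * exp (-s) := by positivity
  have key := le_rpow_mul_rpow_of_le_of_le hx0 ha hb hβ0 hβ1
  refine key.trans (le_of_eq ?_)
  rw [mul_rpow hK hsr, mul_rpow hK (mul_nonneg hs1 (norm_nonneg _)), mul_rpow hs1 (norm_nonneg _)]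
  have hKpow : (16 * C₁ * exp (-s)) ^ (1 - β) * (16 * C₁ * exp (-s)) ^ β = 16 * C₁ * exp (-s) := by
    rw [← rpow_add' hK (by linarith)]; norm_num
  have hspow : (s ^ (-(1 / 2 : ℝ))) ^ (1 - β) * (s ^ (-(1 : ℝ))) ^ β = s ^ (-((1 + β) / 2)) := by
    rw [← rpow_mul hs.le, ← rpow_mul hs.le, ← rpow_add hs]; congr 1; ring
  calc (16 * C₁ * exp (-s)) ^ (1 - β) * (s ^ (-(1 / 2 : ℝ))) ^ (1 - β) *
        ((16 * C₁ * exp (-s)) ^ β * ((s ^ (-(1 : ℝ))) ^ β * ‖y - y'‖ ^ β))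
      = ((16 * C₁ * exp (-s)) ^ (1 - β) * (16 * C₁ * exp (-s)) ^ β) *
          ((s ^ (-(1 / 2 : ℝ))) ^ (1 - β) * (s ^ (-(1 : ℝ))) ^ β) * ‖y - y'‖ ^ β := by ring
    _ = 16 * C₁ * (s ^ (-((1 + β) / 2)) * exp (-s)) * ‖y - y'‖ ^ β := by rw [hKpow, hspow]; ring

/-- **The free resolvent maps `C¹`-bounded data into `C^{2,β}`** (`0 < β < 1`): with `I_β = ∫₀^∞ s^{-(1+β)/2} e^{-s} ds`,
`‖D²W(y) − D²W(y')‖ ≤ 16 C₁ I_β ‖y − y'‖^β` for all `y, y'`, where `W = ∫₀^∞ W_s ds` and `D²W = ∫₀^∞ D²W_s ds`. -/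
theorem norm_fderiv_fderiv_freeResolvent_sub_le (hF : ContDiff ℝ 1 F) (h0 : ∀ z, ‖F z‖ ≤ C₀) (h1 : ∀ z, ‖fderiv ℝ F z‖ ≤ C₁)
    (α : ℝ) {β : ℝ} (hβ0 : 0 < β) (hβ1 : β < 1) (y y' : EuclideanSpace ℝ (Fin 3)) :
    ‖fderiv ℝ (fderiv ℝ (fun y => ∫ s in Ioi (0:ℝ), (Real.exp (-(s / 2)) • rotZL (-(α * s)))
        (heatExtension F (1 - Real.exp (-s)) ((Real.exp (-(s / 2)) • rotZL (α * s)) y)))) y -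
      fderiv ℝ (fderiv ℝ (fun y => ∫ s in Ioi (0:ℝ), (Real.exp (-(s / 2)) • rotZL (-(α * s)))
        (heatExtension F (1 - Real.exp (-s)) ((Real.exp (-(s / 2)) • rotZL (α * s)) y)))) y'‖ ≤
      16 * C₁ * (∫ s in Ioi (0:ℝ), s ^ (-((1 + β) / 2)) * exp (-s)) * ‖y - y'‖ ^ β := by
  have hFc := hF.continuous
  have hC₁ : 0 ≤ C₁ := (norm_nonneg _).trans (h1 0)
  -- `D²W = ∫ D²W_s`
  have hD1 : fderiv ℝ (fun y => ∫ s in Ioi (0:ℝ), (Real.exp (-(s / 2)) • rotZL (-(α * s)))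
        (heatExtension F (1 - Real.exp (-s)) ((Real.exp (-(s / 2)) • rotZL (α * s)) y))) =
      fun y => ∫ s in Ioi (0:ℝ), fderiv ℝ (fun z => (Real.exp (-(s / 2)) • rotZL (-(α * s)))
        (heatExtension F (1 - Real.exp (-s)) ((Real.exp (-(s / 2)) • rotZL (α * s)) z))) y :=
    funext fun y => (hasFDerivAt_freeResolvent hF h0 h1 α y).fderiv
  have hD2 : ∀ z, fderiv ℝ (fderiv ℝ (fun y => ∫ s in Ioi (0:ℝ), (Real.exp (-(s / 2)) • rotZL (-(α * s)))
        (heatExtension F (1 - Real.exp (-s)) ((Real.exp (-(s / 2)) • rotZL (α * s)) y)))) z =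
      ∫ s in Ioi (0:ℝ), fderiv ℝ (fun z => fderiv ℝ (fun z => (Real.exp (-(s / 2)) • rotZL (-(α * s)))
        (heatExtension F (1 - Real.exp (-s)) ((Real.exp (-(s / 2)) • rotZL (α * s)) z))) z) z := by
    intro z; rw [hD1]; exact (hasFDerivAt_fderiv_freeResolvent hF h0 h1 α z).fderiv
  -- the integrable Hölder kernel
  have hI : IntegrableOn (fun s : ℝ => s ^ (-((1 + β) / 2)) * exp (-s)) (Ioi 0) := by
    have h : IntegrableOn (fun s : ℝ => s ^ (-((1 + β) / 2)) * exp (-(1:ℝ) * s ^ (1:ℝ))) (Ioi 0) :=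
      integrableOn_rpow_mul_exp_neg_mul_rpow (by linarith) le_rfl one_pos
    exact h.congr_fun (fun s _ => by simp only [rpow_one, neg_mul, one_mul]) measurableSet_Ioi
  have hI0 : 0 ≤ ∫ s in Ioi (0:ℝ), s ^ (-((1 + β) / 2)) * exp (-s) :=
    setIntegral_nonneg measurableSet_Ioi fun s hs => by have : 0 < s := hs; positivity
  have hC0 : 0 ≤ 16 * C₁ * (∫ s in Ioi (0:ℝ), s ^ (-((1 + β) / 2)) * exp (-s)) * ‖y - y'‖ ^ β :=
    mul_nonneg (mul_nonneg (by positivity) hI0) (by positivity)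
  -- test against two vectors
  set T := fderiv ℝ (fderiv ℝ (fun y => ∫ s in Ioi (0:ℝ), (Real.exp (-(s / 2)) • rotZL (-(α * s)))
        (heatExtension F (1 - Real.exp (-s)) ((Real.exp (-(s / 2)) • rotZL (α * s)) y)))) y -
      fderiv ℝ (fderiv ℝ (fun y => ∫ s in Ioi (0:ℝ), (Real.exp (-(s / 2)) • rotZL (-(α * s)))
        (heatExtension F (1 - Real.exp (-s)) ((Real.exp (-(s / 2)) • rotZL (α * s)) y)))) y' with hT
  refine ContinuousLinearMap.opNorm_le_bound₂ T hC0 fun v w => ?_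
  simp only [hT, sub_apply]
  rw [hD2 y, hD2 y']
  -- integrability of the slices' second derivatives under the normed structure fixed by `integral_apply`
  have hb : IntegrableOn (fun s : ℝ => (2 : ℝ) ^ ((3 : ℝ) / 2) * C₁ * (s ^ (-(1 / 2 : ℝ)) * exp (-s))) (Ioi 0) := by
    have h : IntegrableOn (fun s : ℝ => s ^ (-(1 / 2 : ℝ)) * exp (-((1:ℝ) * s))) (Ioi 0) :=
      integrableOn_rpow_neg_half_mul_exp_neg one_pos
    have h' : IntegrableOn (fun s : ℝ => s ^ (-(1 / 2 : ℝ)) * exp (-s)) (Ioi 0) :=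
      h.congr_fun (fun s _ => by simp only [one_mul]) measurableSet_Ioi
    exact h'.const_mul _
  have happly : ∀ z, (∫ s in Ioi (0:ℝ), fderiv ℝ (fun z => fderiv ℝ (fun z => (Real.exp (-(s / 2)) • rotZL (-(α * s)))
        (heatExtension F (1 - Real.exp (-s)) ((Real.exp (-(s / 2)) • rotZL (α * s)) z))) z) z) v w =
      ∫ s in Ioi (0:ℝ), fderiv ℝ (fun z => fderiv ℝ (fun z => (Real.exp (-(s / 2)) • rotZL (-(α * s)))
        (heatExtension F (1 - Real.exp (-s)) ((Real.exp (-(s / 2)) • rotZL (α * s)) z))) z) z v w := by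
    intro z
    rw [ContinuousLinearMap.integral_apply ?hI2, ContinuousLinearMap.integral_apply ?hI1]
    case hI2 =>
      refine Integrable.mono' hb ?_ ?_
      · exact (continuousOn_fderiv_fderiv_freeSlice hFc h0 α z).aestronglyMeasurable measurableSet_Ioi
      · exact (ae_restrict_iff' measurableSet_Ioi).2
          (Eventually.of_forall fun s hs => norm_fderiv_fderiv_freeSlice_le_rpow hF h0 h1 α hs z)
    case hI1 =>
      refine Integrable.mono' (hb.mul_const ‖v‖) ?_ ?_
      · exact ((continuousOn_fderiv_fderiv_freeSlice hFc h0 α z).clm_apply continuousOn_const).aestronglyMeasurable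
          measurableSet_Ioi
      · refine (ae_restrict_iff' measurableSet_Ioi).2 (Eventually.of_forall fun s hs => ?_)
        exact (ContinuousLinearMap.le_opNorm _ _).trans (mul_le_mul_of_nonneg_right
          (norm_fderiv_fderiv_freeSlice_le_rpow hF h0 h1 α hs z) (norm_nonneg _))
  rw [happly y, happly y', ← integral_sub (integrableOn_fderiv_fderiv_freeSlice_apply hF h0 h1 α y v w)
    (integrableOn_fderiv_fderiv_freeSlice_apply hF h0 h1 α y' v w)]
  have hbound : ∀ s ∈ Ioi (0:ℝ), ‖fderiv ℝ (fun z => fderiv ℝ (fun z => (Real.exp (-(s / 2)) • rotZL (-(α * s)))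
        (heatExtension F (1 - Real.exp (-s)) ((Real.exp (-(s / 2)) • rotZL (α * s)) z))) z) y v w -
      fderiv ℝ (fun z => fderiv ℝ (fun z => (Real.exp (-(s / 2)) • rotZL (-(α * s)))
        (heatExtension F (1 - Real.exp (-s)) ((Real.exp (-(s / 2)) • rotZL (α * s)) z))) z) y' v w‖ ≤
      16 * C₁ * ‖y - y'‖ ^ β * ‖v‖ * ‖w‖ * (s ^ (-((1 + β) / 2)) * exp (-s)) := by
    intro s hs
    have h := norm_fderiv_fderiv_freeSlice_sub_le_rpow hF h0 h1 α hβ0.le hβ1.le hs y y'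
    calc _ = ‖(fderiv ℝ (fun z => fderiv ℝ (fun z => (Real.exp (-(s / 2)) • rotZL (-(α * s)))
            (heatExtension F (1 - Real.exp (-s)) ((Real.exp (-(s / 2)) • rotZL (α * s)) z))) z) y -
          fderiv ℝ (fun z => fderiv ℝ (fun z => (Real.exp (-(s / 2)) • rotZL (-(α * s)))
            (heatExtension F (1 - Real.exp (-s)) ((Real.exp (-(s / 2)) • rotZL (α * s)) z))) z) y') v w‖ := by
          simp only [sub_apply]
      _ ≤ ‖(fderiv ℝ (fun z => fderiv ℝ (fun z => (Real.exp (-(s / 2)) • rotZL (-(α * s)))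
            (heatExtension F (1 - Real.exp (-s)) ((Real.exp (-(s / 2)) • rotZL (α * s)) z))) z) y -
          fderiv ℝ (fun z => fderiv ℝ (fun z => (Real.exp (-(s / 2)) • rotZL (-(α * s)))
            (heatExtension F (1 - Real.exp (-s)) ((Real.exp (-(s / 2)) • rotZL (α * s)) z))) z) y') v‖ * ‖w‖ :=
          ContinuousLinearMap.le_opNorm _ _
      _ ≤ ‖fderiv ℝ (fun z => fderiv ℝ (fun z => (Real.exp (-(s / 2)) • rotZL (-(α * s)))
            (heatExtension F (1 - Real.exp (-s)) ((Real.exp (-(s / 2)) • rotZL (α * s)) z))) z) y -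
          fderiv ℝ (fun z => fderiv ℝ (fun z => (Real.exp (-(s / 2)) • rotZL (-(α * s)))
            (heatExtension F (1 - Real.exp (-s)) ((Real.exp (-(s / 2)) • rotZL (α * s)) z))) z) y'‖ * ‖v‖ * ‖w‖ :=
          mul_le_mul_of_nonneg_right (ContinuousLinearMap.le_opNorm _ _) (norm_nonneg _)
      _ ≤ 16 * C₁ * (s ^ (-((1 + β) / 2)) * exp (-s)) * ‖y - y'‖ ^ β * ‖v‖ * ‖w‖ := by gcongr
      _ = _ := by ring
  have h := norm_integral_le_of_norm_le (hI.const_mul (16 * C₁ * ‖y - y'‖ ^ β * ‖v‖ * ‖w‖))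
    ((ae_restrict_iff' measurableSet_Ioi).2 (Eventually.of_forall hbound))
  rw [integral_const_mul] at h
  calc _ ≤ _ := h
    _ = 16 * C₁ * (∫ s in Ioi (0:ℝ), s ^ (-((1 + β) / 2)) * exp (-s)) * ‖y - y'‖ ^ β * ‖v‖ * ‖w‖ := by ring

end Gain

end Summit.NavierStokesRegularity.NavierStokesRegularity.Theorems.KelvinGate

end
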